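import Mathlib.Analysis.Distribution.AEEqOfIntegralContDiff
import Literature.Analysis.FluidPDE.SuitableWeak
import Literature.Analysis.FluidPDE.HeatDuhamelBack
import HarnessLib

/-!
# Suitable weak solutions: the pressure is determined up to a function of time

Trunk T-FLUID (`Literature/Analysis/FluidPDE`), proofs layer over the accepted structure
`Fluid.IsSuitableWeakSolutionOn` (`SuitableWeak.lean`; Caffarelli–Kohn–Nirenberg 1982, §2,
(2.1)–(2.5); Lin 1998, Def. 1). No new definitions.

In the Navier–Stokes system the pressure enters only through `∇p`, so `(u, p)` and
`(u, p - c(t))` are solutions together, for any function `c` of time alone; for *suitable* weak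
solutions the same holds because the only other occurrence of `p`, the term `2 p u · ∇φ` of the
local energy inequality (2.5), changes by `2 c(t) ∫ u · ∇φ dx = -2 c(t) ∫ (div u) φ dx = 0`
(Caffarelli–Kohn–Nirenberg 1982, §2; this normalisation freedom is used tacitly whenever the
pressure is replaced by `p - [p]_{B}(t)`, e.g. Lin 1998, §3, Seregin–Šverák 2009, §2, and
Albritton–Barker 2019, §3, where the Type I quantity only controls `q - [q]_{x,r}(t')`). This
file proves the statement for the tree's rendering:

* `ae_integral_inner_gradient_eq_zero`: if `u` is locally integrable and weakly divergence free
  on the open space–time region `Q` (the divergence conjunct of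
  `Fluid.IsDistributionalNSSolutionOn`), then for every test function `φ ∈ C_c^∞(Q)` the slices
  satisfy `∫ ⟪u(t, x), ∇φ(t, x)⟫ dx = 0` for a.e. `t` (test against `η(t) φ(t, x)` and apply the
  fundamental lemma of the calculus of variations in `t`, Mathlib
  `ae_eq_zero_of_integral_contDiff_smul_eq_zero`);
* `IsSuitableWeakSolutionOn.sub_pressure`: if `(u, p)` is a suitable weak solution on `Q` and
  `c : ℝ → ℝ` is such that `(t, x) ↦ c(t)` is locally integrable on `Q` and locally `L^{3/2}` on
  `Q` (the integrability class of the pressure), then `(u, p - c)` is a suitable weak solution on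
  `Q` with the same viscosity and force.

No integrability of the full weak integrands is assumed: the subtracted terms are integrable
and integrate to zero, so the (possibly junk) Bochner integrals are unchanged
(`integral_sub_eq_self_of_integral_eq_zero`).

## References

* L. Caffarelli, R. Kohn, L. Nirenberg, *Partial regularity of suitable weak solutions of the
  Navier–Stokes equations*, Comm. Pure Appl. Math. 35 (1982), 771–831, §2.
* F. Lin, *A new proof of the Caffarelli–Kohn–Nirenberg theorem*, Comm. Pure Appl. Math. 51
  (1998), 241–257, §3.
* D. Albritton, T. Barker, *On local Type I singularities of the Navier–Stokes equations and
  Liouville theorems*, J. Math. Fluid Mech. 21 (2019), arXiv:1811.00502, §1 and §3.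
-/

noncomputable section

open MeasureTheory TopologicalSpace Set Function Filter Topology Module Metric
open scoped InnerProductSpace RealInnerProductSpace ENNReal NNReal Laplacian

namespace Literature.Analysis.FluidPDE

variable {E : Type*} [NormedAddCommGroup E] [InnerProductSpace ℝ E] [FiniteDimensional ℝ E]
  [MeasurableSpace E] [BorelSpace E]

/-! ### Tools -/

section Tools

/-- Subtracting an integrable function with vanishing integral does not change a Bochner
integral, integrable or not (if `F` is not integrable neither is `F - g`, and both integrals are
the junk value `0`). [folklore] -/
theorem integral_sub_eq_self_of_integral_eq_zero {α : Type*} [MeasurableSpace α]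
    {μ : Measure α} {G : Type*} [NormedAddCommGroup G] [NormedSpace ℝ G] {F g : α → G}
    (hg : Integrable g μ) (h0 : ∫ a, g a ∂μ = 0) :
    ∫ a, (F a - g a) ∂μ = ∫ a, F a ∂μ := by
  by_cases hF : Integrable F μ
  · rw [integral_sub hF hg, h0, sub_zero]
  · have hF' : ¬ Integrable (fun a => F a - g a) μ := by
      intro h
      refine hF ?_
      have h2 := h.add hg
      have e : ((fun a => F a - g a) + g) = F := by funext a; simp
      rwa [e] at h2
    rw [integral_undef hF, integral_undef hF']

omit [MeasurableSpace E] [BorelSpace E] [InnerProductSpace ℝ E] [FiniteDimensional ℝ E] in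
/-- `η(t) φ(t, x)` is a test function on `Q` whenever `φ` is and `η ∈ C^∞(ℝ)`. [folklore] -/
theorem IsSpaceTimeTestOn.time_mul [NormedSpace ℝ E] {Q : Opens (ℝ × E)} {φ : ℝ → E → ℝ}
    (hφ : IsSpaceTimeTestOn Q φ) {η : ℝ → ℝ} (hη : ContDiff ℝ (⊤ : ℕ∞) η) :
    IsSpaceTimeTestOn Q (fun t x => η t * φ t x) where
  contDiff := by
    have : uncurry (fun t x => η t * φ t x) = fun z : ℝ × E => η z.1 * uncurry φ z := rfl
    rw [this]
    exact (hη.comp contDiff_fst).mul hφ.contDiff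
  hasCompactSupport := by
    have : uncurry (fun t x => η t * φ t x) = (fun z : ℝ × E => η z.1) * uncurry φ := rfl
    rw [this]
    exact hφ.hasCompactSupport.mul_left
  tsupport_subset := by
    have : uncurry (fun t x => η t * φ t x) = (fun z : ℝ × E => η z.1) * uncurry φ := rfl
    rw [this]
    exact (tsupport_mul_subset_right).trans hφ.tsupport_subset

omit [MeasurableSpace E] [BorelSpace E] in
/-- The spatial gradient field `(t, x) ↦ ∇φ(t, ·)(x)` of a space–time test function is
continuous, compactly supported, and vanishes off the support of `φ`. [folklore] -/
theorem IsSpaceTimeTestOn.continuous_gradient_field {Q : Opens (ℝ × E)} {φ : ℝ → E → ℝ}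
    (hφ : IsSpaceTimeTestOn Q φ) :
    Continuous (fun z : ℝ × E => gradient (φ z.1) z.2) ∧
      HasCompactSupport (fun z : ℝ × E => gradient (φ z.1) z.2) ∧
      ∀ z : ℝ × E, z ∉ tsupport (uncurry φ) → gradient (φ z.1) z.2 = 0 := by
  have hφ' : IsSpaceTimeTestOn (⊤ : Opens (ℝ × E)) φ := hφ.mono le_top
  have h1 : Continuous (fun z : ℝ × E => fderiv ℝ (φ z.1) z.2) :=
    hφ'.fderiv_top.contDiff.continuous
  have h0 : ∀ z : ℝ × E, z ∉ tsupport (uncurry φ) → gradient (φ z.1) z.2 = 0 := by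
    rintro ⟨t, x⟩ hz
    simp [gradient, IsSpaceTimeTestOn.fderiv_slice_eq_zero_of_notMem hz]
  refine ⟨(InnerProductSpace.toDual ℝ E).symm.continuous.comp h1, ?_, h0⟩
  exact HasCompactSupport.intro hφ.hasCompactSupport fun z hz => h0 z hz

omit [MeasurableSpace E] [BorelSpace E] in
/-- The divergence field `(t, x) ↦ div ψ(t, ·)(x)` of a space–time test field is continuous
and vanishes off the support of `ψ`. [folklore] -/
theorem IsSpaceTimeTestOn.continuous_divergence_field {Q : Opens (ℝ × E)} {ψ : ℝ → E → E}
    (hψ : IsSpaceTimeTestOn Q ψ) :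
    Continuous (fun z : ℝ × E => VectorCalculus.divergence (ψ z.1) z.2) ∧
      ∀ z : ℝ × E, z ∉ tsupport (uncurry ψ) → VectorCalculus.divergence (ψ z.1) z.2 = 0 := by
  have hψ' : IsSpaceTimeTestOn (⊤ : Opens (ℝ × E)) ψ := hψ.mono le_top
  have h1 : Continuous (fun z : ℝ × E => fderiv ℝ (ψ z.1) z.2) :=
    hψ'.fderiv_top.contDiff.continuous
  refine ⟨?_, ?_⟩
  · have : (fun z : ℝ × E => VectorCalculus.divergence (ψ z.1) z.2) = fun z => ∑ i, ⟪stdOrthonormalBasis ℝ E i,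
        fderiv ℝ (ψ z.1) z.2 (stdOrthonormalBasis ℝ E i)⟫ := by
      funext z
      exact divergence_eq_sum_inner_fderiv (stdOrthonormalBasis ℝ E) (ψ z.1) z.2
    rw [this]
    exact continuous_finsetSum _ fun i _ => continuous_const.inner (h1.clm_apply continuous_const)
  · rintro ⟨t, x⟩ hz
    simp [VectorCalculus.divergence, IsSpaceTimeTestOn.fderiv_slice_eq_zero_of_notMem hz]

/-- A locally integrable field paired with a continuous field supported in a compact subset of
`Q` is integrable on the whole space–time. [folklore] -/
theorem integrable_inner_of_locallyIntegrableOn {Q : Opens (ℝ × E)} {u : ℝ → E → E}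
    (hu : LocallyIntegrableOn (uncurry u) (Q : Set (ℝ × E)) volume) {w : ℝ × E → E}
    (hw : Continuous w) {K : Set (ℝ × E)} (hK : IsCompact K) (hKQ : K ⊆ (Q : Set (ℝ × E)))
    (hwK : ∀ z ∉ K, w z = 0) :
    Integrable (fun z : ℝ × E => ⟪u z.1 z.2, w z⟫) (volume : Measure (ℝ × E)) := by
  have huK : IntegrableOn (uncurry u) K volume := hu.integrableOn_compact_subset hKQ hK
  have hwc : HasCompactSupport w := HasCompactSupport.intro hK hwK
  obtain ⟨C, hC⟩ := hw.bounded_above_of_compact_support hwc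
  have hsupp : support (fun z : ℝ × E => ⟪u z.1 z.2, w z⟫) ⊆ K := by
    intro z hz
    by_contra hzK
    exact hz (by simp [hwK z hzK])
  refine (integrableOn_iff_integrable_of_support_subset hsupp).1 ?_
  refine Integrable.mono' (huK.norm.mul_const C)
    (huK.aestronglyMeasurable.inner hw.aestronglyMeasurable) ?_
  filter_upwards with z
  calc ‖⟪u z.1 z.2, w z⟫‖ ≤ ‖u z.1 z.2‖ * ‖w z‖ := norm_inner_le_norm _ _
    _ ≤ ‖uncurry u z‖ * C := mul_le_mul_of_nonneg_left (hC z) (norm_nonneg _)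

/-- A locally integrable scalar multiplied by a continuous function supported in a compact
subset of `Q` is integrable on the whole space–time. [folklore] -/
theorem integrable_mul_of_locallyIntegrableOn {Q : Opens (ℝ × E)} {F : ℝ × E → ℝ}
    (hF : LocallyIntegrableOn F (Q : Set (ℝ × E)) volume) {w : ℝ × E → ℝ}
    (hw : Continuous w) {K : Set (ℝ × E)} (hK : IsCompact K) (hKQ : K ⊆ (Q : Set (ℝ × E)))
    (hwK : ∀ z ∉ K, w z = 0) :
    Integrable (fun z : ℝ × E => F z * w z) (volume : Measure (ℝ × E)) := by
  have hFK : IntegrableOn F K volume := hF.integrableOn_compact_subset hKQ hK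
  have hwc : HasCompactSupport w := HasCompactSupport.intro hK hwK
  obtain ⟨C, hC⟩ := hw.bounded_above_of_compact_support hwc
  have hsupp : support (fun z : ℝ × E => F z * w z) ⊆ K := by
    intro z hz
    by_contra hzK
    exact hz (by simp [hwK z hzK])
  refine (integrableOn_iff_integrable_of_support_subset hsupp).1 ?_
  refine Integrable.mono' (hFK.norm.mul_const C)
    (hFK.aestronglyMeasurable.mul hw.aestronglyMeasurable) ?_
  filter_upwards with z
  rw [norm_mul]
  exact mul_le_mul_of_nonneg_left (hC z) (norm_nonneg _)

/-- **Weakly divergence-free fields are slice-wise divergence free.** If `u` is locally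
integrable on the open region `Q ⊆ ℝ × E` and `∫∫_Q ⟪u, ∇θ⟫ = 0` for all `θ ∈ C_c^∞(Q)` (the
divergence conjunct of `Fluid.IsDistributionalNSSolutionOn`, CKN 1982, (2.2)), then for every
`φ ∈ C_c^∞(Q)`, `∫ ⟪u(t, x), ∇φ(t, ·)(x)⟫ dx = 0` for a.e. `t`: testing with
`θ(t, x) = η(t) φ(t, x)`, `η ∈ C_c^∞(ℝ)`, gives `∫ η(t) g(t) dt = 0` for the integrable function
`g(t) = ∫ ⟪u(t), ∇φ(t)⟫ dx`, whence `g = 0` a.e. (fundamental lemma of the calculus of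
variations). [cite: CaffarelliKohnNirenberg1982, §2 (2.2)] -/
theorem ae_integral_inner_gradient_eq_zero {Q : Opens (ℝ × E)} {u : ℝ → E → E}
    (hu : LocallyIntegrableOn (uncurry u) (Q : Set (ℝ × E)) volume)
    (hdiv : ∀ θ : ℝ → E → ℝ, IsSpaceTimeTestOn Q θ →
      ∫ z in (Q : Set (ℝ × E)), ⟪u z.1 z.2, gradient (θ z.1) z.2⟫ = 0)
    {φ : ℝ → E → ℝ} (hφ : IsSpaceTimeTestOn Q φ) :
    ∀ᵐ t : ℝ, ∫ x, ⟪u t x, gradient (φ t) x⟫ = 0 := by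
  obtain ⟨hwc, -, hw0⟩ := hφ.continuous_gradient_field
  set K := tsupport (uncurry φ) with hK
  have hKc : IsCompact K := hφ.hasCompactSupport
  have hKQ : K ⊆ (Q : Set (ℝ × E)) := hφ.tsupport_subset
  have hI : Integrable (fun z : ℝ × E => ⟪u z.1 z.2, gradient (φ z.1) z.2⟫)
      (volume : Measure (ℝ × E)) :=
    integrable_inner_of_locallyIntegrableOn hu hwc hKc hKQ hw0
  set g : ℝ → ℝ := fun t => ∫ x, ⟪u t x, gradient (φ t) x⟫ with hg
  have hgI : Integrable g (volume : Measure ℝ) := hI.integral_prod_left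
  refine ae_eq_zero_of_integral_contDiff_smul_eq_zero hgI.locallyIntegrable fun η hη hηc => ?_
  -- test the divergence constraint against `θ = η(t) φ(t, x)`
  have hθ : IsSpaceTimeTestOn Q (fun t x => η t * φ t x) := hφ.time_mul hη
  have key := hdiv _ hθ
  have hgrad : ∀ t x, gradient (fun x => η t * φ t x) x = η t • gradient (φ t) x := by
    intro t x
    have hd : DifferentiableAt ℝ (φ t) x :=
      ((hφ.contDiff_slice t).differentiable (by simp)).differentiableAt
    rw [gradient, gradient, fderiv_const_mul hd, map_smul]
  simp_rw [hgrad, real_inner_smul_right] at key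
  -- pass from `∫_Q` to `∫_{ℝ × E}` and to the iterated integral
  obtain ⟨C, hC⟩ := hη.continuous.bounded_above_of_compact_support hηc
  have hI2 : Integrable (fun z : ℝ × E => η z.1 * ⟪u z.1 z.2, gradient (φ z.1) z.2⟫)
      (volume : Measure (ℝ × E)) :=
    hI.bdd_mul ((hη.continuous.comp continuous_fst).aestronglyMeasurable)
      (Eventually.of_forall fun z => hC z.1)
  have hzero : ∀ z : ℝ × E, z ∉ (Q : Set (ℝ × E)) →
      η z.1 * ⟪u z.1 z.2, gradient (φ z.1) z.2⟫ = 0 := by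
    intro z hz
    rw [hw0 z fun h => hz (hKQ h), inner_zero_right, mul_zero]
  rw [setIntegral_eq_integral_of_forall_compl_eq_zero hzero, Measure.volume_eq_prod,
    integral_prod _ hI2] at key
  show ∫ t, η t * (∫ x, ⟪u t x, gradient (φ t) x⟫) = 0
  simp_rw [← integral_const_mul]
  exact key

end Tools

/-! ### Normalising the pressure by a function of time -/

section Pressure

variable {Q : Opens (ℝ × E)} {ν : ℝ} {f u : ℝ → E → E} {p : ℝ → E → ℝ}

/-- **The pressure of a suitable weak solution is determined only up to a function of time.**
If `(u, p)` is a suitable weak solution on the open region `Q` (Caffarelli–Kohn–Nirenberg 1982,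
(2.1)–(2.5)) and `c : ℝ → ℝ` is a function of time with `(t, x) ↦ c(t)` locally integrable and
locally `L^{3/2}` on `Q`, then `(u, p - c)` is again a suitable weak solution on `Q`, with the
same viscosity, force and weak gradient: in the momentum equation the extra term is
`∫ c(t) (∫ div ψ(t, ·) dx) dt = 0` (divergence theorem for the compactly supported slices), and
in the local energy inequality (2.5) the extra term `-2 ∫ c(t) (∫ ⟪u, ∇φ⟫ dx) dt` vanishes
because `u` is weakly divergence free slice-wise (`ae_integral_inner_gradient_eq_zero`). This
is the normalisation freedom used when the pressure is replaced by `q - [q]_{B}(t)` (Lin 1998,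
§3; Albritton–Barker 2019, §1, the mean-free quantity `D`).
[cite: CaffarelliKohnNirenberg1982, §2] -/
theorem IsSuitableWeakSolutionOn.sub_pressure (h : IsSuitableWeakSolutionOn Q ν f u p)
    {c : ℝ → ℝ} (hc : LocallyIntegrableOn (fun z : ℝ × E => c z.1) (Q : Set (ℝ × E)) volume)
    (hc' : ∀ K ⊆ (Q : Set (ℝ × E)), IsCompact K → ∫⁻ z in K, ‖c z.1‖ₑ ^ (3 / 2 : ℝ) < ∞) :
    IsSuitableWeakSolutionOn Q ν f u (fun t x => p t x - c t) := by
  obtain ⟨hu, hu2, hp, hdiv, hmom⟩ := h.distributional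
  obtain ⟨G, hG, hG2, hloc⟩ := h.localEnergy
  refine
    { distributional := ⟨hu, hu2, ?_, hdiv, fun ψ hψ => ?_⟩
      energyClass := h.energyClass
      pressure := ?_
      localEnergy := ⟨G, hG, hG2, fun φ hφ hφ0 => ?_⟩ }
  · -- `p - c ∈ L¹_loc(Q)`
    have e : uncurry (fun t x => p t x - c t) = uncurry p - fun z : ℝ × E => c z.1 := rfl
    rw [e]
    exact hp.sub hc
  · -- the momentum equation: `∫ c(t) div ψ = 0`
    obtain ⟨hwc, hw0⟩ := hψ.continuous_divergence_field
    have hKc : IsCompact (tsupport (uncurry ψ)) := hψ.hasCompactSupport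
    have hKQ : tsupport (uncurry ψ) ⊆ (Q : Set (ℝ × E)) := hψ.tsupport_subset
    have hI : Integrable (fun z : ℝ × E => c z.1 * VectorCalculus.divergence (ψ z.1) z.2)
        (volume : Measure (ℝ × E)) :=
      integrable_mul_of_locallyIntegrableOn hc hwc hKc hKQ hw0
    have hzero : ∫ z in (Q : Set (ℝ × E)), c z.1 * VectorCalculus.divergence (ψ z.1) z.2 = 0 := by
      have h0 : ∀ z : ℝ × E, z ∉ (Q : Set (ℝ × E)) → c z.1 * VectorCalculus.divergence (ψ z.1) z.2 = 0 :=
        fun z hz => by rw [hw0 z fun h' => hz (hKQ h'), mul_zero]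
      rw [setIntegral_eq_integral_of_forall_compl_eq_zero h0, Measure.volume_eq_prod,
        integral_prod _ hI]
      have h1 : ∀ t : ℝ, ∫ x, c t * VectorCalculus.divergence (ψ t) x = 0 := by
        intro t
        rw [integral_const_mul, integral_divergence_eq_zero
          ((hψ.contDiff_slice t).of_le (by
            change ((1 : ℕ∞) : WithTop ℕ∞) ≤ ((⊤ : ℕ∞) : WithTop ℕ∞)
            exact_mod_cast le_top)) (hψ.hasCompactSupport_slice t), mul_zero]
      simp only [h1, integral_zero]
    have key := hmom ψ hψ
    have e : ∀ z : ℝ × E,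
        ⟪u z.1 z.2, timeDeriv ψ z.1 z.2⟫ + ⟪u z.1 z.2, convect (u z.1) (ψ z.1) z.2⟫ +
            ν * ⟪u z.1 z.2, Δ (ψ z.1) z.2⟫ +
            (fun t x => p t x - c t) z.1 z.2 * VectorCalculus.divergence (ψ z.1) z.2 + ⟪f z.1 z.2, ψ z.1 z.2⟫ =
          (⟪u z.1 z.2, timeDeriv ψ z.1 z.2⟫ + ⟪u z.1 z.2, convect (u z.1) (ψ z.1) z.2⟫ +
            ν * ⟪u z.1 z.2, Δ (ψ z.1) z.2⟫ +
            p z.1 z.2 * VectorCalculus.divergence (ψ z.1) z.2 + ⟪f z.1 z.2, ψ z.1 z.2⟫) -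
          c z.1 * VectorCalculus.divergence (ψ z.1) z.2 := by
      intro z
      simp only
      ring
    simp_rw [e]
    rw [integral_sub_eq_self_of_integral_eq_zero hI.integrableOn hzero]
    exact key
  · -- `p - c ∈ L^{3/2}_loc(Q)`
    intro K hK hKc
    have hpK : IntegrableOn (uncurry p) K volume := hp.integrableOn_compact_subset hK hKc
    have hmeas : AEMeasurable (fun z : ℝ × E => ‖p z.1 z.2‖ₑ ^ (3 / 2 : ℝ)) (volume.restrict K) :=
      hpK.aestronglyMeasurable.aemeasurable.enorm.pow_const _
    have hle : ∀ z : ℝ × E, ‖p z.1 z.2 - c z.1‖ₑ ^ (3 / 2 : ℝ) ≤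
        2 ^ ((3 / 2 : ℝ) - 1) * (‖p z.1 z.2‖ₑ ^ (3 / 2 : ℝ) + ‖c z.1‖ₑ ^ (3 / 2 : ℝ)) := by
      intro z
      calc ‖p z.1 z.2 - c z.1‖ₑ ^ (3 / 2 : ℝ)
          ≤ (‖p z.1 z.2‖ₑ + ‖c z.1‖ₑ) ^ (3 / 2 : ℝ) := by
            gcongr
            exact enorm_sub_le
        _ ≤ 2 ^ ((3 / 2 : ℝ) - 1) * (‖p z.1 z.2‖ₑ ^ (3 / 2 : ℝ) + ‖c z.1‖ₑ ^ (3 / 2 : ℝ)) :=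
            ENNReal.rpow_add_le_mul_rpow_add_rpow _ _ (by norm_num)
    calc ∫⁻ z in K, ‖(fun t x => p t x - c t) z.1 z.2‖ₑ ^ (3 / 2 : ℝ)
        ≤ ∫⁻ z in K, 2 ^ ((3 / 2 : ℝ) - 1) *
            (‖p z.1 z.2‖ₑ ^ (3 / 2 : ℝ) + ‖c z.1‖ₑ ^ (3 / 2 : ℝ)) := lintegral_mono fun z => hle z
      _ = 2 ^ ((3 / 2 : ℝ) - 1) * ((∫⁻ z in K, ‖p z.1 z.2‖ₑ ^ (3 / 2 : ℝ)) +
            ∫⁻ z in K, ‖c z.1‖ₑ ^ (3 / 2 : ℝ)) := by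
          rw [lintegral_const_mul' _ _ (ENNReal.rpow_ne_top_of_nonneg (by norm_num) (by simp)),
            lintegral_add_left' hmeas]
      _ < ∞ := ENNReal.mul_lt_top (ENNReal.rpow_lt_top_of_nonneg (by norm_num) (by simp))
          (ENNReal.add_lt_top.2 ⟨h.pressure K hK hKc, hc' K hK hKc⟩)
  · -- the local energy inequality: the extra term `-2 ∫ c(t) ∫ ⟪u, ∇φ⟫` vanishes
    have key := hloc φ hφ hφ0
    obtain ⟨hwc, -, hw0⟩ := hφ.continuous_gradient_field
    have hKc : IsCompact (tsupport (uncurry φ)) := hφ.hasCompactSupport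
    have hKQ : tsupport (uncurry φ) ⊆ (Q : Set (ℝ × E)) := hφ.tsupport_subset
    have hI : Integrable (fun z : ℝ × E => ⟪u z.1 z.2, gradient (φ z.1) z.2⟫)
        (volume : Measure (ℝ × E)) :=
      integrable_inner_of_locallyIntegrableOn hu hwc hKc hKQ hw0
    have hslice : ∀ᵐ t : ℝ, Integrable (fun x => ⟪u t x, gradient (φ t) x⟫) (volume : Measure E) :=
      hI.prod_right_ae
    have hdiv0 : ∀ᵐ t : ℝ, ∫ x, ⟪u t x, gradient (φ t) x⟫ = 0 :=
      ae_integral_inner_gradient_eq_zero hu hdiv hφ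
    have e : ∀ t x,
        ‖u t x‖ ^ 2 * (timeDeriv φ t x + ν * Δ (φ t) x) +
            (‖u t x‖ ^ 2 + 2 * (fun t x => p t x - c t) t x) * ⟪u t x, gradient (φ t) x⟫ +
            2 * ⟪f t x, u t x⟫ * φ t x =
          (‖u t x‖ ^ 2 * (timeDeriv φ t x + ν * Δ (φ t) x) +
            (‖u t x‖ ^ 2 + 2 * p t x) * ⟪u t x, gradient (φ t) x⟫ +
            2 * ⟪f t x, u t x⟫ * φ t x) -
          2 * c t * ⟪u t x, gradient (φ t) x⟫ := by
      intro t x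
      simp only
      ring
    have hint : ∫ t, ∫ x, (‖u t x‖ ^ 2 * (timeDeriv φ t x + ν * Δ (φ t) x) +
          (‖u t x‖ ^ 2 + 2 * (fun t x => p t x - c t) t x) * ⟪u t x, gradient (φ t) x⟫ +
          2 * ⟪f t x, u t x⟫ * φ t x) =
        ∫ t, ∫ x, (‖u t x‖ ^ 2 * (timeDeriv φ t x + ν * Δ (φ t) x) +
          (‖u t x‖ ^ 2 + 2 * p t x) * ⟪u t x, gradient (φ t) x⟫ +
          2 * ⟪f t x, u t x⟫ * φ t x) := by
      simp_rw [e]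
      refine integral_congr_ae ?_
      filter_upwards [hslice, hdiv0] with t h1 h2
      refine integral_sub_eq_self_of_integral_eq_zero (h1.const_mul (2 * c t)) ?_
      rw [integral_const_mul, h2, mul_zero]
    rw [hint]
    exact key

end Pressure

end Literature.Analysis.FluidPDE
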